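import Summits.ABC.ABC.Theses.DefiniteXi
import Literature.NumberTheory.EllipticCurves.NewformPeterssonSizeCMReductionProofs
import Literature.NumberTheory.EllipticCurves.NewformPeterssonSizeSymmSqLZeroFreeProofs
import Literature.NumberTheory.EllipticCurves.LFunctionCoefficientBound
import Summits.ABC.ABC.Theorems.DefiniteXiPeterssonLowerBoundStubLocalGHL
import Summits.ABC.ABC.Theorems.DefiniteXiPeterssonLowerBoundStubSymmSqLLogEuler
import Summits.ABC.ABC.Theorems.DefiniteXiPeterssonLowerBoundStubZE
import Literature.NumberTheory.EllipticCurves.NewformSymmSquareJ0Hecke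
import HarnessLib
import Literature.NumberTheory.Automorphic.KimSymmetricFourthGL2

/-!
# The crux `DefiniteXi.PeterssonLowerBound` (stmt-ABC-10870) from the analytic package of `L(s, Sym⁴ E)`

The crux is verbatim the named fact `murty_petersson_newform_lower_bound`. Given the tree
(`NewformPeterssonSize{SymmSqLZeroFree,CMReduction}Proofs`) its residual content is
(R1) no exceptional real zero of `L_f = symmSqL N f` for the newforms of NON-CM elliptic curves
(Goldfeld–Hoffstein–Lieman 1994) and (R2) `L_f(1) ≫ N^{-ε}` on the CM family `j = 0`.

Composition (`PeterssonLowerBound_of`, conditional on ONE NAMED FACT: the analytic package of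
`L(s, Sym⁴ E)` for non-CM `E/ℚ` (Kim 2003 + Kim–Shahidi 2002), here the hypothesis `hSym4`;
Hasse's bound is a theorem of the tree, `WeierstrassCurve.abs_LFunction_prime_pow_le`):

* `stub_localGHL` — disc-local "a zero of order `m+1` near a pole of order `m`" repulsion
  (Titchmarsh's Lemma α, `Literature.Analysis.Complex.titchmarsh_logDeriv_sub_sum_of_differentiableOn`);
* `stub_symmSqL_logEuler` — log-Euler product of `symmSqL N f · ∏_{p ∣ N}(1 + p^{-s})` on `Re s > 1`;
* `stub_ZE` — the auxiliary `Z_E = ζ² (L_f·corr)³ L₄` on the Siegel ball: `≥ 1`, `Z'/Z ≤ 0` on the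
  real axis right of `1`, holomorphy and `N^{O(1)}` bound, order `≥ 3` at a real zero of `L_f`;
* `ramanujan_of_isNewformOf` (proved) — `|a_p(f)| ≤ 2√p` from the tree's Hasse bound;
* (R2) the `j = 0` family: `exists_symmSqLOne_ge_of_j_eq_zero` (`NewformSymmSquareJ0Hecke`, Hecke `L`-functions of `ℚ(√-3)`);
* glue (here): R1 from these, then the crux from R1, the `j = 0` theorem, the tree's case-A engine
  `petersson_lower_bound_log_of_symmSqL_zeroFree` and `exists_petersson_ge_of_hasCM_of_j_ne_zero`.
-/

noncomputable section

open scoped Real Topology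
open Set Filter Metric Complex CongruenceSubgroup
open Literature.NumberTheory.EllipticCurves.ModularForms
open Literature.NumberTheory.LFunctions

set_option linter.dupNamespace false

namespace Summit.ABC.ABC.Theorems

/-! ### Stubs 1–3 (`stub_localGHL`, `stub_symmSqL_logEuler`, `stub_ZE`): LANDED; (R2) `j = 0` is a Literature theorem

The stubs are imported from `Summits/ABC/ABC/Theorems/DefiniteXiPeterssonLowerBoundStub{LocalGHL,SymmSqLLogEuler,ZE}.lean`
(p98483, p103615, p103973); the `j = 0` family is `exists_symmSqLOne_ge_of_j_eq_zero`
(`Literature/NumberTheory/EllipticCurves/NewformSymmSquareJ0Hecke.lean`; also landed as the registered stub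
`stub_j0`, `…StubJ0.lean`, p105349). -/

/-! ### The one automorphic input: the analytic package of `L(s, Sym⁴ E)` for non-CM `E/ℚ` (NAMED FACT) -/

/-- **`|a_p(f)| ≤ 2√p`** for the newform `f` of an elliptic curve `W/ℚ` (`a_p(f) = a_p(W)`,
`IsNewformOf`) at every prime, from the tree's unconditional Hasse bound
`WeierstrassCurve.abs_LFunction_prime_pow_le` (Manin's elementary proof, `HasseElementary`).
[cite: SilvermanAEC2009, Thm. V.1.1] -/
theorem ramanujan_of_isNewformOf (N : ℕ) [NeZero N] (W : WeierstrassCurve ℚ) [W.IsElliptic]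
    (f : CuspForm (Gamma0 N) 2) (hf : IsNewformOf W f) :
    ∀ p : ℕ, p.Prime → ¬ p ∣ N → |(cuspCoeff f p).re| ≤ 2 * Real.sqrt p := by
  intro p hp _
  have h := WeierstrassCurve.abs_LFunction_prime_pow_le W hp 1
  rw [pow_one, pow_one, Nat.cast_one, show (1 : ℝ) + 1 = 2 by norm_num] at h
  rw [hf.2 p, Complex.intCast_re]
  exact h

/-! ### Glue: (R1) no exceptional zero for non-CM curves, then the crux -/

/-- **(R1) conditional**: Hasse + the `Sym⁴` package give a constant `A > 0` such that for every
non-CM elliptic newform with `L_f(1) < 1`, `L_f(σ) ≠ 0` on `[1 - 1/(A log(N+2)), 1)`.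
[cite: HoffsteinLockhart1994, Appendix (Goldfeld–Hoffstein–Lieman)] -/
theorem symmSqL_nonCM_zeroFree
    (hSym4 : Literature.NumberTheory.Automorphic.Kim2003_symmFourL_nonCM_entire_polyBound) :
    ∃ A : ℝ, 0 < A ∧ ∀ (N : ℕ) [NeZero N] (W : WeierstrassCurve ℚ) [W.IsElliptic]
      (f : CuspForm (Gamma0 N) 2), IsNewformOf W f → ¬ W.HasCM → (symmSqL N f 1).re < 1 →
        ∀ σ : ℝ, 1 - 1 / (A * Real.log (N + 2)) ≤ σ → σ < 1 → symmSqL N f σ ≠ 0 := by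
  obtain ⟨r, hr0, _hr4, _hr, hZE⟩ := stub_ZE
  obtain ⟨C, K, hC, hK, h4⟩ := hSym4
  obtain ⟨A, hA, hZE'⟩ := hZE C K hC hK
  obtain ⟨c, hc, hGHL⟩ := stub_localGHL 2 hr0
  have hlog2 : (0 : ℝ) < Real.log 2 := Real.log_pos (by norm_num)
  refine ⟨max (2 * A / c) (2 / (r * Real.log 2)), lt_max_of_lt_left (by positivity), ?_⟩
  intro N _ W _ f hf hCM hL1 σ h1σ h2σ hzero
  set A' : ℝ := max (2 * A / c) (2 / (r * Real.log 2)) with hA'def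
  have hA'0 : 0 < A' := lt_max_of_lt_left (by positivity)
  have hN0 : (0 : ℝ) ≤ N := Nat.cast_nonneg N
  have hlogN : Real.log 2 ≤ Real.log (N + 2) := Real.log_le_log (by norm_num) (by linarith)
  have hlogN0 : 0 < Real.log (N + 2) := by linarith
  -- `1/(A' log(N+2)) ≤ r/2`, so `σ > 1 - r`
  have hr2 : 1 / (A' * Real.log (N + 2)) ≤ r / 2 := by
    have h1 : 2 / (r * Real.log 2) * Real.log 2 ≤ A' * Real.log (N + 2) :=
      mul_le_mul (le_max_right _ _) hlogN hlog2.le hA'0.le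
    have h2 : 2 / (r * Real.log 2) * Real.log 2 = 2 / r := by
      field_simp
    rw [h2] at h1
    rw [div_le_iff₀ (by positivity)]
    have := (div_le_iff₀ hr0).mp (le_refl (2 / r))
    nlinarith [h1, hr0]
  have hσr : 1 - r < σ := by linarith
  -- `1/(A' log(N+2)) ≤ (c/2)/(A log(N+2))`
  have hcA : 1 / (A' * Real.log (N + 2)) ≤ c / (2 * A * Real.log (N + 2)) := by
    rw [div_le_div_iff₀ (by positivity) (by positivity), one_mul]
    have h1 : 2 * A / c ≤ A' := le_max_left _ _
    have h2 : 2 * A ≤ A' * c := by rwa [div_le_iff₀ hc] at h1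
    nlinarith [h2, hlogN0]
  -- the data of the auxiliary function
  obtain ⟨L₄, hL₄d, hL₄E, hL₄b⟩ := h4 N W f hf hCM
  have hE := fun (s : ℂ) (hs : 1 < s.re) ↦
    stub_symmSqL_logEuler N f hf.1 (ramanujan_of_isNewformOf N W f hf) hs
  obtain ⟨G, Z, B, hB1, hBA, hGd, hGb, hGz, hGZ, hZ1, hZ'⟩ :=
    hZE' N f hf.1 hE L₄ hL₄d hL₄E hL₄b hL1 σ hσr h2σ hzero
  have hβ := hGHL G Z B σ hB1 h2σ hGd hGb hGz hGZ hZ1 hZ'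
  -- `c/B ≥ c/(A log(N+2)) ≥ 2/(A' log(N+2))`: contradiction with `h1σ`
  have hB0 : 0 < B := by linarith
  have h3 : c / (A * Real.log (N + 2)) ≤ c / B :=
    div_le_div_of_nonneg_left hc.le hB0 hBA
  have h4' : c / (2 * A * Real.log (N + 2)) < c / (A * Real.log (N + 2)) := by
    apply div_lt_div_of_pos_left hc (by positivity)
    nlinarith [hA, hlogN0]
  linarith

/-- **The crux, conditionally on Hasse's bound and the `Sym⁴` package** (and modulo the stubs).
[cite: HoffsteinLockhart1994, Thm. 0.1] [cite: MurtyCongruencePrimes1999, §2] -/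
theorem PeterssonLowerBound_of
    (hSym4 : Literature.NumberTheory.Automorphic.Kim2003_symmFourL_nonCM_entire_polyBound) :
    Summit.ABC.ABC.Theses.DefiniteXi.PeterssonLowerBound := by
  obtain ⟨A, hA, hZF⟩ := symmSqL_nonCM_zeroFree hSym4
  obtain ⟨A₀, _hA₀, h1⟩ := petersson_lower_bound_log_of_symmSqL_zeroFree
  obtain ⟨c₁, hc₁, hc₁N⟩ := h1 (max A A₀) (le_max_right _ _)
  intro ε hε
  obtain ⟨c₂, hc₂, h₂⟩ := exists_petersson_ge_of_hasCM_of_j_ne_zero hε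
  obtain ⟨c₃, hc₃, h₃⟩ := exists_symmSqLOne_ge_of_j_eq_zero hε
  have hπ := Real.pi_pos
  have h3ε : (0 : ℝ) < (3 : ℝ) ^ ε := Real.rpow_pos_of_pos (by norm_num) _
  refine ⟨min (min (1 / (8 * π ^ 3)) (c₁ * ε / (3 : ℝ) ^ ε)) (min c₂ (c₃ / (8 * π ^ 3))),
    by positivity, fun N _ W _ f hf ↦ ?_⟩
  have hN0' : N ≠ 0 := NeZero.ne N
  have hN0 : (0 : ℝ) < N := Nat.cast_pos.mpr (NeZero.pos N)
  have hN1 : (1 : ℝ) ≤ N := by exact_mod_cast NeZero.one_le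
  have hNε : (0 : ℝ) ≤ (N : ℝ) ^ (1 - ε) := Real.rpow_nonneg hN0.le _
  have hsplit : (N : ℝ) ^ (1 - ε) = (N : ℝ) ^ (-ε) * N := by
    rw [show (1 : ℝ) - ε = -ε + 1 by ring, Real.rpow_add hN0, Real.rpow_one]
  have hNle : (N : ℝ) ^ (1 - ε) ≤ N := by
    calc (N : ℝ) ^ (1 - ε) ≤ (N : ℝ) ^ (1 : ℝ) :=
          Real.rpow_le_rpow_of_exponent_le hN1 (by linarith)
      _ = N := Real.rpow_one _
  set P : ℝ := (peterssonProduct (Gamma0 N) 2 f f).re with hP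
  have hP0 : 0 ≤ P := re_peterssonProduct_self_nonneg f
  by_cases hj0 : W.j = 0
  · -- the family `j = 0`
    have key := h₃ ⟨N, W, f, hf⟩ hj0
    simp only [] at key
    rw [symmSqLOne_eq] at key
    -- `c₃ N^{-ε} ≤ 8π³ P / N`
    have h1 : c₃ * (N : ℝ) ^ (-ε) * N ≤ 8 * π ^ 3 * P := by
      have := (le_div_iff₀ hN0).mp key
      linarith
    calc min (min (1 / (8 * π ^ 3)) (c₁ * ε / (3 : ℝ) ^ ε)) (min c₂ (c₃ / (8 * π ^ 3))) * (N : ℝ) ^ (1 - ε)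
        ≤ c₃ / (8 * π ^ 3) * (N : ℝ) ^ (1 - ε) :=
          mul_le_mul_of_nonneg_right ((min_le_right _ _).trans (min_le_right _ _)) hNε
      _ = c₃ * (N : ℝ) ^ (-ε) * N / (8 * π ^ 3) := by rw [hsplit]; ring
      _ ≤ P := by rw [div_le_iff₀ (by positivity)]; linarith
  · by_cases hCM : W.HasCM
    · -- CM with `j ≠ 0`: the tree
      calc min (min (1 / (8 * π ^ 3)) (c₁ * ε / (3 : ℝ) ^ ε)) (min c₂ (c₃ / (8 * π ^ 3))) * (N : ℝ) ^ (1 - ε)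
          ≤ c₂ * (N : ℝ) ^ (1 - ε) :=
            mul_le_mul_of_nonneg_right ((min_le_right _ _).trans (min_le_left _ _)) hNε
        _ ≤ P := h₂ N W f hf hCM hj0
    · by_cases hL : 1 ≤ (symmSqL N f 1).re
      · -- `L_f(1) ≥ 1`: `P = [SL₂(ℤ):Γ₀(N)] L_f(1)/(8π³) ≥ N/(8π³)`
        have hidx : (N : ℝ) ≤ gamma0Index N := by exact_mod_cast le_gamma0Index hN0'
        have hidx0 : (0 : ℝ) < gamma0Index N := by exact_mod_cast gamma0Index_pos N
        rw [symmSqL_one, Complex.ofReal_re, le_div_iff₀ hidx0, one_mul] at hL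
        calc min (min (1 / (8 * π ^ 3)) (c₁ * ε / (3 : ℝ) ^ ε)) (min c₂ (c₃ / (8 * π ^ 3))) * (N : ℝ) ^ (1 - ε)
            ≤ 1 / (8 * π ^ 3) * (N : ℝ) ^ (1 - ε) :=
              mul_le_mul_of_nonneg_right ((min_le_left _ _).trans (min_le_left _ _)) hNε
          _ ≤ 1 / (8 * π ^ 3) * gamma0Index N :=
              mul_le_mul_of_nonneg_left (hNle.trans hidx) (by positivity)
          _ ≤ P := by rw [one_div_mul_eq_div, div_le_iff₀ (by positivity)]; linarith
      · -- `L_f(1) < 1`: zero-free interval (R1) and the case-A engine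
        push Not at hL
        have hlogN0 : 0 < Real.log (N + 2) := Real.log_pos (by linarith)
        have hAmax : 0 < max A A₀ := lt_of_lt_of_le hA (le_max_left _ _)
        have hZ' : ∀ σ : ℝ, 1 - 1 / (max A A₀ * Real.log (N + 2)) ≤ σ → σ < 1 →
            symmSqL N f σ ≠ 0 := by
          intro σ h1σ h2σ
          refine hZF N W f hf hCM hL σ (le_trans ?_ h1σ) h2σ
          have : 1 / (max A A₀ * Real.log (N + 2)) ≤ 1 / (A * Real.log (N + 2)) := by
            apply one_div_le_one_div_of_le (by positivity)
            exact mul_le_mul_of_nonneg_right (le_max_left _ _) hlogN0.le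
          linarith
        have hmain := hc₁N N f hf.1.2.2 hZ'
        have hlog : Real.log (N + 2) ≤ (3 : ℝ) ^ ε * (N : ℝ) ^ ε / ε := by
          have h1 : Real.log ((N : ℝ) + 2) ≤ ((N : ℝ) + 2) ^ ε / ε :=
            Real.log_le_rpow_div (by positivity) hε
          have h2 : ((N : ℝ) + 2) ^ ε ≤ (3 * (N : ℝ)) ^ ε :=
            Real.rpow_le_rpow (by linarith) (by linarith) hε.le
          rw [Real.mul_rpow (by norm_num) hN0.le] at h2
          calc Real.log ((N : ℝ) + 2) ≤ ((N : ℝ) + 2) ^ ε / ε := h1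
            _ ≤ (3 : ℝ) ^ ε * (N : ℝ) ^ ε / ε := by gcongr
        calc min (min (1 / (8 * π ^ 3)) (c₁ * ε / (3 : ℝ) ^ ε)) (min c₂ (c₃ / (8 * π ^ 3))) * (N : ℝ) ^ (1 - ε)
            ≤ c₁ * ε / (3 : ℝ) ^ ε * (N : ℝ) ^ (1 - ε) :=
              mul_le_mul_of_nonneg_right ((min_le_left _ _).trans (min_le_right _ _)) hNε
          _ = c₁ * N / ((3 : ℝ) ^ ε * (N : ℝ) ^ ε / ε) := by
              rw [Real.rpow_sub hN0, Real.rpow_one]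
              field_simp
          _ ≤ c₁ * N / Real.log (N + 2) := by
              apply div_le_div_of_nonneg_left (by positivity) hlogN0 hlog
          _ ≤ P := hmain

end Summit.ABC.ABC.Theorems

end
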